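import Mathlib.Analysis.Calculus.ContDiff.WithLp
import Literature.Analysis.FunctionSpaces.TorusInverseLaplacianCalculus
import Literature.Analysis.FunctionSpaces.TorusEnstrophyOrthogonality
import Literature.Analysis.FunctionSpaces.TorusCalculusProofs
import Literature.Analysis.FluidPDE.TorusClassicalH1Balance
import HarnessLib

/-!
# Miller's strain projection `P_{st}` on the flat torus: the `L²`-orthogonal projection onto the
# strain space `L²_{st} = {∇_{sym}u : ∇·u = 0}`, as an explicit smooth operator

Analysis/FluidPDE support file (definitions with bodies + fully proved API; no named facts).
Search for candidate a priori estimates; no regularity claim.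

E. Miller writes the Navier–Stokes equation as an evolution equation for the strain
`S = ∇_{sym}u` on the constraint space

  `L²_{st} = {½∇⊗u + ½(∇⊗u)* : u ∈ Ḣ¹, ∇·u = 0}`  (ARMA 235 (2020), Def 2.2; Anal. PDE 16 (2023),
  Def 1.2),

with `P_{st}` "the projection onto `L²_{st}`" (Anal. PDE 16 (2023), eq. (1.9); Pure Appl. Anal. 8 (2026),
(1.9)): `∂ₜS − ΔS + P_{st}((u·∇)S + S² + ¼ω⊗ω) = 0`, using that Hessians and multiples of the identity
are `L²`-orthogonal to `L²_{st}` (ARMA 235 (2020), Prop 2.4) and that the velocity is recovered from the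
strain by `u = −2 div(−Δ)⁻¹S` (ARMA 235 (2020), display (2.7); Anal. PDE 16 (2023), Prop 1.4). The
perturbative regularity criteria of Pure Appl. Anal. 8 (2026), Thms 1.8–1.9, are stated in terms of
`‖P_{st}((u·∇)S + S² + ¾ω⊗ω)‖` — so a faithful typing of those criteria (sequel file
`TorusNSStrainProjectionCriterion`) needs `P_{st}` as an honest operator. This file provides it on the
flat torus `T^d = UnitAddTorus d` (any `d`), on SMOOTH matrix fields `M = (M_{ab})`,
`M : d → d → (T^d → ℝ)` (the entry-wise vocabulary of the cell's other strain files), by the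
explicit formula behind the abstract projection:

* `Torus.strainDiv M` — `(div_{sym}M)_b = ∑_c ∂_c ½(M_{cb} + M_{bc})`;
* `Torus.strainDivDiv M` — `div div (sym M) = ∑_b ∂_b (div_{sym}M)_b`;
* `Torus.strainPotential M : T^d → ℝ^d` — `z_M = 2Δ⁻¹div_{sym}M − 2∇Δ⁻²(div div sym M)`
  `= −2(−Δ)⁻¹ ℙ div(sym M)` (Miller's `u = −2 div(−Δ)⁻¹S`, Leray-projected; `Δ⁻¹` the mean-zero
  inverse Laplacian `Torus.invLaplacian` of Cheskidov–Luo 2022, §7.2, tree file `TorusInverseLaplacian`);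
* `Torus.strainProjection M` — **`(P_{st}M)_{ab} = ½((∂_a z_M)_b + (∂_b z_M)_a) = (∇_{sym}z_M)_{ab}`**.

That this is the orthogonal projection onto the smooth part of `L²_{st}` (extended by `0` on
antisymmetric fields, which are `L²`-orthogonal to all symmetric ones) is PROVED:

* `Torus.isDivFree_strainPotential`, `Torus.integral_strainPotential_apply` — `z_M` is smooth
  (`Torus.isSmooth_strainPotential`), divergence free and mean zero, so `P_{st}M = ∇_{sym}z_M ∈ L²_{st}`;
* `Torus.integral_sum_strainProjection_mul_symGrad_eq` — **`⟨P_{st}M, ∇_{sym}u⟩ = ⟨M, ∇_{sym}u⟩` for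
  every smooth divergence-free `u`** (`M − P_{st}M ⊥ L²_{st}`); the computation is Miller's proof of
  ARMA Prop 2.3 (`−2div ∇_{sym}u = −Δu`) run backwards, with `Δ⁻¹` symmetric and `Δ⁻¹Δu = u − ∫u`;
* `Torus.strainProjection_symGrad` — **`P_{st}(∇_{sym}u) = ∇_{sym}u`** for smooth divergence-free `u`
  (ARMA (2.7)/Prop 2.3); `Torus.strainProjection_strainProjection` — `P_{st}² = P_{st}`;
  `Torus.integral_sum_strainProjection_mul_comm` — `P_{st}` is self-adjoint;
  `Torus.integral_sum_strainProjection_sq_eq` / `…_sq_le` — `‖P_{st}M‖² = ⟨M, P_{st}M⟩ ≤ ‖M‖²`;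
* `Torus.strainProjection_hessian`, `Torus.strainProjection_diagonal` — **`P_{st}(Hess f) = 0`,
  `P_{st}(gI) = 0`** (ARMA Prop 2.4: `Hess f, gI ∈ (L²_{st})^⊥`);
* tools: `StrainProjection.integral_sum_symGradScalar_mul_symGrad_eq`
  (`⟨∇_{sym}z, ∇_{sym}u⟩ = −½⟨z, Δu⟩` for `div u = 0`), `Torus.integral_sum_sum_mul_le_sqrt_mul_sqrt`
  (Cauchy–Schwarz for matrix fields), smoothness of all the pieces, `Torus.strainProjection_comm`
  (symmetry of `P_{st}M`).

Scope (faithfulness): Miller's `L²_{st}`, `P_{st}` live on `ℝ³` and on `L²` classes; here the flat torus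
`T^d` (any finite `d`, nonempty where `Δ⁻¹` is inverted) and smooth fields, which is the setting of the
functional-mining census and of the sequel criterion file; the characterising identities (range in the
strains of divergence-free mean-zero fields, `M − P_{st}M ⊥` strains, `P_{st} = id` on strains) are the
`T^d` transcriptions of ARMA Def 2.2 / Prop 2.3 / Prop 2.4. Uniqueness of the orthogonal projection makes
the explicit representative canonical; the `L²`-closure / `Ḣ¹` functional setting is NOT developed here.
These serve the functional-mining cell (pub-nsfunc): CRITERIA queue item (β) (Miller 2026 Thms 1.8–1.9 need
`P_{st}`), and the dictionary's strain family (projected nonlinearities as candidate integrands).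

## Mathlib / tree search

Tree (used): `Torus.invLaplacian` with `isSmooth_invLaplacian`, `laplacian_invLaplacian`,
`invLaplacian_laplacian`, `integral_invLaplacian`, `partialDeriv_invLaplacian`, `invLaplacian_finset_sum`,
`invLaplacian_const_smul`, `invLaplacian_sub`, `invLaplacian_zero` (`TorusInverseLaplacian(Calculus)`);
`Torus.partialDeriv_apply_coord`, `divergence_eq_sum_partialDeriv_apply`, `partialDeriv_finset_sum`,
`partialDeriv_comm` (`TorusEnstrophyOrthogonality`); `Torus.partialDeriv_mul/add/const_smul/neg`,
`laplacian_eq_sum_partialDeriv_partialDeriv`, `integral_mul_laplacian_eq_neg_sum`,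
`integral_partialDeriv_eq_zero_holds` (`TorusCalculusProofs`, `TorusTestFunction`);
`Torus.IsDivFree.laplacian_of_isSmooth`, `Torus.isSmooth_fun_finset_sum` (`TorusClassicalH1Balance`);
Mathlib `contDiff_piLp`, `discrim_le_zero`. The symmetry `∫(Δ⁻¹a)b = ∫a(Δ⁻¹b)` exists as
`Torus.integral_invLaplacian_mul_comm` in `TorusInvLaplacianGradientLp` (Riesz-transform imports); it is
re-proved privately here to keep this file's imports light. Searched (`lean search`):
`strainProj|P_st|L2_st|strainSpace|symGrad.*proj` — nothing in Mathlib or the tree; the Leray–Helmholtz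
files (`TorusLerayHelmholtz*`, `LerayProjector`) project VECTOR fields, not matrix fields.

## References

* [Miller2019] E. Miller, *A regularity criterion for the Navier–Stokes equation involving only the
  middle eigenvalue of the strain tensor*, Arch. Ration. Mech. Anal. 235 (2020) 99–139 =
  arXiv:1710.05569: §2 display (2.7) (`u = −2 div(−Δ)⁻¹S`), Def 2.2 (`L²_{st}`), Prop 2.3 with proof,
  Prop 2.4 (held text paper:arxiv-1710.05569, chunks 8–9).
* [Miller2023StrainModel] E. Miller, *Finite-time blowup for a Navier–Stokes model equation for the
  self-amplification of strain*, Anal. PDE 16 (2023) 997–1032 = arXiv:1910.05415: Def 1.2, Prop 1.3,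
  Prop 1.4, eq. (1.9) (`P_{st}`) (held text paper:arxiv-1910.05415, chunk 4).
* [Miller2026StrainVorticity] E. Miller, Pure Appl. Anal. 8 (2026) 247–270 = arXiv:2407.02691, (1.9),
  Thms 1.8–1.9 (the consumer).
* [CheskidovLuo2022] A. Cheskidov, X. Luo, Invent. Math. 229 (2022), §7.2 (`Δ⁻¹` on `C^∞(T^d)`).
* [Evans2010] L. C. Evans, *Partial Differential Equations*, 2nd ed., App. B.2, C.2 (Cauchy–Schwarz;
  integration by parts).
-/

noncomputable section

open MeasureTheory Set Function Finset
open scoped ContDiff InnerProductSpace RealInnerProductSpace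

namespace Literature.Analysis.FluidPDE

open Literature.Analysis.FunctionSpaces

variable {d : Type*} [Fintype d] [DecidableEq d]

/-! ### The explicit operator -/

/-- **Symmetrised divergence of a matrix field** `M = (M_{cb})` on `T^d`:
`(div_{sym} M)_b = ∑_c ∂_c ½(M_{cb} + M_{bc})` — the vector field `div S`, `S = sym M`, of
Miller's reconstruction formula `u = −2 div(−Δ)⁻¹S` (ARMA 235 (2020), eq. before Def 2.2;
Anal. PDE 16 (2023), Prop 1.4). [cite: Miller2019, §2, display before Def 2.2 (`u = −2 div(−Δ)⁻¹S`)] -/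
def Torus.strainDiv (M : d → d → UnitAddTorus d → ℝ) (b : d) (y : UnitAddTorus d) : ℝ :=
  ∑ c, Torus.partialDeriv c (fun z => (M c b z + M b c z) / 2) y

/-- **Double divergence** `div div (sym M) = ∑_b ∂_b (div_{sym} M)_b` of a matrix field on `T^d`
(the scalar `tr((∇⊗∇)S) = ∑ᵢⱼ ∂ᵢ∂ⱼSᵢⱼ` of Miller, ARMA 235 (2020), proof of Prop 2.4, which
vanishes exactly on the strain space). [cite: Miller2019, Prop 2.4 (proof, display `tr((∇⊗∇)S) = ∑ ∂ᵢ∂ⱼSᵢⱼ`)] -/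
def Torus.strainDivDiv (M : d → d → UnitAddTorus d → ℝ) (y : UnitAddTorus d) : ℝ :=
  ∑ b, Torus.partialDeriv b (Torus.strainDiv M b) y

/-- **The velocity potential of the strain projection**: the smooth divergence-free, mean-zero
vector field `z_M = 2Δ⁻¹ div_{sym}M − 2∇Δ⁻²(div div sym M) = −2(−Δ)⁻¹ ℙ div(sym M)` (`ℙ` the
Leray projector), i.e. Miller's reconstruction `u = −2 div(−Δ)⁻¹ S` (ARMA 235 (2020), display
before Def 2.2; Anal. PDE 16 (2023), Prop 1.4: "`S = ∇_{sym}u`, `u = −2 div(−Δ)⁻¹S`") applied to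
the symmetric part of an arbitrary smooth matrix field and followed by the Leray projection, so
that `∇_{sym} z_M = P_{st} M` (`Torus.strainProjection`). On the flat torus `Δ⁻¹` is the
mean-zero inverse Laplacian `Torus.invLaplacian` (Cheskidov–Luo 2022, §7.2).
[cite: Miller2019, §2, display before Def 2.2 (`u = −2 div(−Δ)⁻¹S`); Miller2023StrainModel, Prop 1.4] -/
def Torus.strainPotential (M : d → d → UnitAddTorus d → ℝ) (y : UnitAddTorus d) :
    EuclideanSpace ℝ d :=
  WithLp.toLp 2 fun b =>
    2 * Torus.invLaplacian (Torus.strainDiv M b) y -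
      2 * Torus.partialDeriv b (Torus.invLaplacian (Torus.invLaplacian (Torus.strainDivDiv M))) y

/-- **Miller's strain projection `P_{st}`** — the `L²`-orthogonal projection of (symmetric) matrix
fields onto the strain space `L²_{st} = {∇_{sym}u : ∇·u = 0}` (Miller, ARMA 235 (2020), Def 2.2;
Anal. PDE 16 (2023), Def 1.2 and eq. (1.9): "the Navier–Stokes strain equation can be expressed
in terms of the projection onto `L²_{st}` as `∂ₜS − ΔS + P_{st}((u·∇)S + S² + ¼ω⊗ω) = 0`";
Pure Appl. Anal. 8 (2026), (1.9)), realised on smooth matrix fields `M = (M_{ab})` on the flat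
torus `T^d` by the explicit smooth representative
`(P_{st}M)_{ab} = ½((∂_a z_M)_b + (∂_b z_M)_a) = (∇_{sym} z_M)_{ab}`, `z_M = Torus.strainPotential M`
(`= −2(−Δ)⁻¹ℙ div(sym M)`). That this IS the orthogonal projection onto the (smooth) strains is
the content of `Torus.isDivFree_strainPotential` (range `⊆ L²_{st}`),
`Torus.integral_sum_strainProjection_mul_symGrad_eq` (`M − P_{st}M ⊥ L²_{st}`) and
`Torus.strainProjection_symGrad` (`P_{st} = id` on `L²_{st}`); the antisymmetric part of `M` is
discarded (`P_{st}` is extended by `0` on antisymmetric fields, which are `L²`-orthogonal to all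
symmetric ones). [cite: Miller2023StrainModel, Def 1.2 and eq. (1.9) (`P_{st}` = projection onto `L²_{st}`); Miller2019, Def 2.2] -/
def Torus.strainProjection (M : d → d → UnitAddTorus d → ℝ) (a b : d) (x : UnitAddTorus d) : ℝ :=
  (Torus.partialDeriv a (Torus.strainPotential M) x b +
    Torus.partialDeriv b (Torus.strainPotential M) x a) / 2

namespace StrainProjection

/-! ### Smoothness bookkeeping -/

variable {M : d → d → UnitAddTorus d → ℝ}

omit [DecidableEq d] in
/-- Finite sums of smooth scalar functions are smooth. [folklore] -/
private theorem isSmooth_sum {ι : Type*} (s : Finset ι) {g : ι → UnitAddTorus d → ℝ}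
    (hg : ∀ i ∈ s, Torus.IsSmooth (g i)) : Torus.IsSmooth (fun x => ∑ i ∈ s, g i x) := by
  have hl : Torus.lift (fun x => ∑ i ∈ s, g i x) = fun z => ∑ i ∈ s, Torus.lift (g i) z := rfl
  unfold Torus.IsSmooth
  rw [hl]
  exact ContDiff.sum fun i hi => hg i hi

omit [DecidableEq d] in
/-- The symmetrised entries `½(M_{cb} + M_{bc})` are smooth. [folklore] -/
private theorem isSmooth_symm (hM : ∀ a b, Torus.IsSmooth (M a b)) (c b : d) :
    Torus.IsSmooth (fun z => (M c b z + M b c z) / 2) :=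
  ((hM c b).add (hM b c)).div_const 2

omit [DecidableEq d] in
/-- Products of smooth scalar functions are smooth (with the product written pointwise, so that the
conclusion is syntactically an `IsSmooth` statement). [folklore] -/
private theorem smooth_mul {a b : UnitAddTorus d → ℝ} (ha : Torus.IsSmooth a) (hb : Torus.IsSmooth b) :
    Torus.IsSmooth (fun y => a y * b y) := ha.mul hb

omit [DecidableEq d] in
/-- Constant multiples of smooth scalar functions are smooth. [folklore] -/
private theorem smooth_const_mul (c : ℝ) {a : UnitAddTorus d → ℝ} (ha : Torus.IsSmooth a) :
    Torus.IsSmooth (fun y => c * a y) := (Torus.isSmooth_const c).mul ha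

/-- `div_{sym}M` is smooth for a smooth matrix field. [cite: Miller2019, §2 display (2.7); CheskidovLuo2022, §7.2] -/
theorem _root_.Literature.Analysis.FluidPDE.Torus.isSmooth_strainDiv (hM : ∀ a b, Torus.IsSmooth (M a b)) (b : d) :
    Torus.IsSmooth (Torus.strainDiv M b) :=
  isSmooth_sum _ fun c _ => (isSmooth_symm hM c b).partialDeriv c

/-- `div div (sym M)` is smooth for a smooth matrix field. [cite: Miller2019, Prop 2.4 (proof); CheskidovLuo2022, §7.2] -/
theorem _root_.Literature.Analysis.FluidPDE.Torus.isSmooth_strainDivDiv (hM : ∀ a b, Torus.IsSmooth (M a b)) :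
    Torus.IsSmooth (Torus.strainDivDiv M) :=
  isSmooth_sum _ fun b _ => (Torus.isSmooth_strainDiv hM b).partialDeriv b

/-- The components of the potential: `(z_M)_b = 2Δ⁻¹(div_{sym}M)_b − 2∂_bΔ⁻²(div div sym M)`
(unfolding). [cite: Miller2019, §2 display (2.7); Miller2023StrainModel, Prop 1.4] -/
theorem _root_.Literature.Analysis.FluidPDE.Torus.strainPotential_apply (M : d → d → UnitAddTorus d → ℝ) (y : UnitAddTorus d) (b : d) :
    Torus.strainPotential M y b =
      2 * Torus.invLaplacian (Torus.strainDiv M b) y -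
        2 * Torus.partialDeriv b (Torus.invLaplacian (Torus.invLaplacian (Torus.strainDivDiv M))) y :=
  rfl

/-- Each component of the potential `z_M` of a smooth matrix field is smooth (`Δ⁻¹` preserves
smoothness, Cheskidov–Luo 2022, §7.2; tree `Torus.isSmooth_invLaplacian`).
[cite: CheskidovLuo2022, §7.2; Miller2023StrainModel, Prop 1.4] -/
theorem _root_.Literature.Analysis.FluidPDE.Torus.isSmooth_strainPotential_apply (hM : ∀ a b, Torus.IsSmooth (M a b)) (b : d) :
    Torus.IsSmooth (fun y => Torus.strainPotential M y b) := by
  have h1 : Torus.IsSmooth (Torus.invLaplacian (Torus.strainDiv M b)) :=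
    Torus.isSmooth_invLaplacian (Torus.isSmooth_strainDiv hM b)
  have h2 : Torus.IsSmooth (Torus.partialDeriv b
      (Torus.invLaplacian (Torus.invLaplacian (Torus.strainDivDiv M)))) :=
    (Torus.isSmooth_invLaplacian (Torus.isSmooth_invLaplacian (Torus.isSmooth_strainDivDiv hM))).partialDeriv b
  have h3 : Torus.IsSmooth (fun y => 2 * Torus.invLaplacian (Torus.strainDiv M b) y -
      2 * Torus.partialDeriv b (Torus.invLaplacian (Torus.invLaplacian (Torus.strainDivDiv M))) y) :=
    (smooth_const_mul 2 h1).sub (smooth_const_mul 2 h2)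
  exact h3

/-- The potential `z_M` of a smooth matrix field is a smooth vector field on `T^d`.
[cite: CheskidovLuo2022, §7.2; Miller2023StrainModel, Prop 1.4] -/
theorem _root_.Literature.Analysis.FluidPDE.Torus.isSmooth_strainPotential (hM : ∀ a b, Torus.IsSmooth (M a b)) :
    Torus.IsSmooth (Torus.strainPotential M) := by
  unfold Torus.IsSmooth
  rw [contDiff_piLp]
  intro b
  exact Torus.isSmooth_strainPotential_apply hM b

/-- `P_{st}M` is a smooth matrix field for smooth `M` (entries `½((∂_a z_M)_b + (∂_b z_M)_a)` of the
smooth potential). [cite: Miller2023StrainModel, Def 1.2 and eq. (1.9); CheskidovLuo2022, §7.2] -/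
theorem _root_.Literature.Analysis.FluidPDE.Torus.isSmooth_strainProjection (hM : ∀ a b, Torus.IsSmooth (M a b)) (a b : d) :
    Torus.IsSmooth (Torus.strainProjection M a b) := by
  have hZ := Torus.isSmooth_strainPotential hM
  have h : Torus.IsSmooth (fun x => (Torus.partialDeriv a (Torus.strainPotential M) x b +
      Torus.partialDeriv b (Torus.strainPotential M) x a) / 2) :=
    (((hZ.partialDeriv a).apply b).add ((hZ.partialDeriv b).apply a)).div_const 2
  exact h

/-- `P_{st}M` is a symmetric matrix field (`(P_{st}M)_{ab} = (P_{st}M)_{ba}`): `P_{st}` takes values in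
the symmetric matrices `L²(…; S^{d×d}) ⊇ L²_{st}` (Miller, ARMA 235 (2020), Def 2.2).
[cite: Miller2019, Def 2.2] -/
theorem _root_.Literature.Analysis.FluidPDE.Torus.strainProjection_comm (M : d → d → UnitAddTorus d → ℝ) (a b : d) (x : UnitAddTorus d) :
    Torus.strainProjection M a b x = Torus.strainProjection M b a x := by
  simp only [Torus.strainProjection]
  ring

/-! ### Calculus helpers -/

omit [DecidableEq d] in
/-- Pairing a symmetrised array against a symmetric one: `∑_{ab} ½(Z_{ab} + Z_{ba}) U_{ab} = ∑_{ab} Z_{ab} U_{ab}`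
for `U` symmetric. [folklore] -/
private theorem sum_symm_mul_of_symm (Z U : d → d → ℝ) (hU : ∀ a b, U b a = U a b) :
    ∑ a, ∑ b, (Z a b + Z b a) / 2 * U a b = ∑ a, ∑ b, Z a b * U a b := by
  have h1 : ∑ a, ∑ b, Z b a * U a b = ∑ a, ∑ b, Z a b * U a b := by
    rw [Finset.sum_comm]
    exact Finset.sum_congr rfl fun a _ => Finset.sum_congr rfl fun b _ => by rw [hU b a]
  have h2 : ∑ a, ∑ b, (Z a b + Z b a) / 2 * U a b =
      2⁻¹ * (∑ a, ∑ b, Z a b * U a b) + 2⁻¹ * (∑ a, ∑ b, Z b a * U a b) := by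
    simp only [Finset.mul_sum, ← Finset.sum_add_distrib]
    exact Finset.sum_congr rfl fun a _ => Finset.sum_congr rfl fun b _ => by ring
  rw [h2, h1]; ring

/-- Integration by parts for one partial derivative on the torus: `∫ (∂ᵢa) b = −∫ a (∂ᵢb)` for
smooth real `a`, `b` (Evans, App. C.2, Thm. 2, empty boundary). [folklore] -/
private theorem integral_partialDeriv_mul_eq_neg {a b : UnitAddTorus d → ℝ} (ha : Torus.IsSmooth a)
    (hb : Torus.IsSmooth b) (i : d) :
    ∫ x, Torus.partialDeriv i a x * b x = -∫ x, a x * Torus.partialDeriv i b x := by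
  have h0 : ∫ x, Torus.partialDeriv i (fun y => a y * b y) x = 0 :=
    Torus.integral_partialDeriv_eq_zero_holds (smooth_mul ha hb) i
  simp_rw [Torus.partialDeriv_mul (ha.isContDiff (by simp)) (hb.isContDiff (by simp))] at h0
  rw [integral_add (smooth_mul ha (hb.partialDeriv i)).integrable
    (smooth_mul (ha.partialDeriv i) hb).integrable] at h0
  linarith

/-- `Δ⁻¹` is symmetric: `∫ (Δ⁻¹a) b = ∫ a (Δ⁻¹b)` for smooth real `a`, `b` (as in
`TorusInvLaplacianGradientLp`, reproved here to keep the imports light: write `b = ΔΔ⁻¹b + ∫b`,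
`a = ΔΔ⁻¹a + ∫a`, use `∫Δ⁻¹· = 0` and Green's second identity). [folklore] -/
private theorem integral_invLaplacian_mul_comm [Nonempty d] {a b : UnitAddTorus d → ℝ}
    (ha : Torus.IsSmooth a) (hb : Torus.IsSmooth b) :
    ∫ x, Torus.invLaplacian a x * b x = ∫ x, a x * Torus.invLaplacian b x := by
  have hA : Torus.IsSmooth (Torus.invLaplacian a) := Torus.isSmooth_invLaplacian ha
  have hB : Torus.IsSmooth (Torus.invLaplacian b) := Torus.isSmooth_invLaplacian hb
  have hA0 : ∫ x, Torus.invLaplacian a x = 0 := Torus.integral_invLaplacian ha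
  have hB0 : ∫ x, Torus.invLaplacian b x = 0 := Torus.integral_invLaplacian hb
  -- Green's second identity `∫ (Δ⁻¹a) Δ(Δ⁻¹b) = ∫ Δ(Δ⁻¹a) (Δ⁻¹b)`
  have hgreen : ∫ x, Torus.invLaplacian a x * Torus.laplacian (Torus.invLaplacian b) x =
      ∫ x, Torus.laplacian (Torus.invLaplacian a) x * Torus.invLaplacian b x := by
    rw [Torus.integral_mul_laplacian_eq_neg_sum hA hB]
    have h2 := Torus.integral_mul_laplacian_eq_neg_sum hB hA
    have h3 : ∫ x, Torus.laplacian (Torus.invLaplacian a) x * Torus.invLaplacian b x =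
        ∫ x, Torus.invLaplacian b x * Torus.laplacian (Torus.invLaplacian a) x :=
      integral_congr_ae (Filter.Eventually.of_forall fun x => mul_comm _ _)
    rw [h3, h2]
    congr 1
    exact Finset.sum_congr rfl fun i _ =>
      integral_congr_ae (Filter.Eventually.of_forall fun x => mul_comm _ _)
  have e1 : ∀ x, Torus.invLaplacian a x * b x =
      Torus.invLaplacian a x * Torus.laplacian (Torus.invLaplacian b) x + (∫ y, b y) * Torus.invLaplacian a x := by
    intro x; rw [Torus.laplacian_invLaplacian hb x]; ring
  have e2 : ∀ x, a x * Torus.invLaplacian b x =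
      Torus.laplacian (Torus.invLaplacian a) x * Torus.invLaplacian b x + (∫ y, a y) * Torus.invLaplacian b x := by
    intro x; rw [Torus.laplacian_invLaplacian ha x]; ring
  simp_rw [e1, e2]
  rw [integral_add (smooth_mul hA hB.laplacian).integrable (smooth_const_mul _ hA).integrable,
    integral_add (smooth_mul hA.laplacian hB).integrable (smooth_const_mul _ hB).integrable,
    MeasureTheory.integral_const_mul, MeasureTheory.integral_const_mul, hA0, hB0, hgreen, mul_zero,
    mul_zero]

/-- The `b`-th component of the Laplacian of a smooth field is the Laplacian of the `b`-th
component. [folklore] -/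
private theorem laplacian_apply_eq_laplacian_coord {u : UnitAddTorus d → EuclideanSpace ℝ d}
    (hu : Torus.IsSmooth u) (b : d) (x : UnitAddTorus d) :
    Torus.laplacian u x b = Torus.laplacian (fun y => u y b) x := by
  have := Torus.laplacian_clm_comp_apply hu (EuclideanSpace.proj b : EuclideanSpace ℝ d →L[ℝ] ℝ) x
  simpa [Function.comp_def] using this.symm

/-- `(Δu)_b(x) = ∑ₐ ∂ₐ(∂ₐu)_b (x)` for a smooth field. [folklore] -/
private theorem laplacian_apply_eq_sum {u : UnitAddTorus d → EuclideanSpace ℝ d}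
    (hu : Torus.IsSmooth u) (b : d) (x : UnitAddTorus d) :
    Torus.laplacian u x b = ∑ a, Torus.partialDeriv a (fun y => Torus.partialDeriv a u y b) x := by
  rw [laplacian_apply_eq_laplacian_coord hu b x,
    Torus.laplacian_eq_sum_partialDeriv_partialDeriv (hu.apply b)]
  refine Finset.sum_congr rfl fun a _ => ?_
  have e : Torus.partialDeriv a (fun y => u y b) = fun y => Torus.partialDeriv a u y b := by
    funext y; exact Torus.partialDeriv_apply_coord (hu.isContDiff (by simp)) a y b
  rw [e]

/-- `∑ₐ ∂ₐ(∂_b u)ₐ = 0` pointwise for a smooth divergence-free field (`= ∂_b div u`). [folklore] -/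
private theorem sum_partialDeriv_partialDeriv_apply_eq_zero {u : UnitAddTorus d → EuclideanSpace ℝ d}
    (hu : Torus.IsSmooth u) (hdiv : Torus.IsDivFree u) (b : d) (x : UnitAddTorus d) :
    ∑ a, Torus.partialDeriv a (fun y => Torus.partialDeriv b u y a) x = 0 := by
  have hu1 : Torus.IsContDiff 1 u := hu.isContDiff (by simp)
  have hD1 : ∀ m, Torus.IsContDiff 1 (Torus.partialDeriv m u) := fun m =>
    (hu.partialDeriv m).isContDiff (by simp)
  have hDc1 : ∀ m j, Torus.IsContDiff 1 (fun y => Torus.partialDeriv m u y j) := fun m j =>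
    ((hu.partialDeriv m).apply j).isContDiff (by simp)
  have h1 : ∀ a, Torus.partialDeriv a (fun y => Torus.partialDeriv b u y a) x =
      Torus.partialDeriv b (fun y => Torus.partialDeriv a u y a) x := by
    intro a
    rw [Torus.partialDeriv_apply_coord (hD1 b), Torus.partialDeriv_apply_coord (hD1 a),
      Torus.partialDeriv_comm hu a b x]
  simp_rw [h1]
  rw [← Torus.partialDeriv_finset_sum Finset.univ (fun a _ => hDc1 a a)]
  have hdivfun : (fun y => ∑ a, Torus.partialDeriv a u y a) = fun _ => (0 : ℝ) := by
    funext y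
    rw [← Torus.divergence_eq_sum_partialDeriv_apply hu1]
    exact hdiv y
  rw [hdivfun]
  simp [Torus.partialDeriv, Torus.lineDeriv]

/-- **The symmetric gradient paired with a strain**: for smooth scalar components `z_b` and a smooth
divergence-free field `u` on `T^d`,
`∫ ∑_{ab} ½(∂_a z_b + ∂_b z_a) · ½((∂_b u)_a + (∂_a u)_b) = −½ ∑_b ∫ z_b (Δu)_b`
(integrate by parts; the cross term is `∑_b ∫ z_b ∂_b(div u) = 0`; Miller, ARMA 235 (2020),
proof of Prop 2.3: "`−2 div(∇_{sym}u) = −Δu − ∇(∇·u) = −Δu`"). [cite: Miller2019, Prop 2.3 (proof)] -/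
theorem integral_sum_symGradScalar_mul_symGrad_eq {z : d → UnitAddTorus d → ℝ}
    (hz : ∀ b, Torus.IsSmooth (z b)) {u : UnitAddTorus d → EuclideanSpace ℝ d}
    (hu : Torus.IsSmooth u) (hdiv : Torus.IsDivFree u) :
    ∫ x, ∑ a, ∑ b, (Torus.partialDeriv a (z b) x + Torus.partialDeriv b (z a) x) / 2 *
        ((Torus.partialDeriv b u x a + Torus.partialDeriv a u x b) / 2) =
      -(2⁻¹ * ∑ b, ∫ x, z b x * Torus.laplacian u x b) := by
  have hu1 : Torus.IsContDiff 1 u := hu.isContDiff (by simp)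
  have hD1 : ∀ m, Torus.IsContDiff 1 (Torus.partialDeriv m u) := fun m =>
    (hu.partialDeriv m).isContDiff (by simp)
  have hDc : ∀ m j, Torus.IsSmooth (fun y => Torus.partialDeriv m u y j) := fun m j =>
    (hu.partialDeriv m).apply j
  -- pointwise reduction to `∑_{ab} ∂_a z_b (∂_a u)_b /2 + ∂_a z_b (∂_b u)_a / 2`
  have hpt : ∀ x, ∑ a, ∑ b, (Torus.partialDeriv a (z b) x + Torus.partialDeriv b (z a) x) / 2 *
      ((Torus.partialDeriv b u x a + Torus.partialDeriv a u x b) / 2) =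
      2⁻¹ * (∑ a, ∑ b, Torus.partialDeriv a (z b) x * Torus.partialDeriv a u x b) +
        2⁻¹ * (∑ a, ∑ b, Torus.partialDeriv a (z b) x * Torus.partialDeriv b u x a) := by
    intro x
    rw [sum_symm_mul_of_symm (fun a b => Torus.partialDeriv a (z b) x)
      (fun a b => (Torus.partialDeriv b u x a + Torus.partialDeriv a u x b) / 2)
      (fun a b => by ring)]
    simp only [Finset.mul_sum, ← Finset.sum_add_distrib]
    exact Finset.sum_congr rfl fun a _ => Finset.sum_congr rfl fun b _ => by ring
  have hS1 : Torus.IsSmooth (fun x => ∑ a, ∑ b, Torus.partialDeriv a (z b) x * Torus.partialDeriv a u x b) :=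
    isSmooth_sum _ fun a _ => isSmooth_sum _ fun b _ => smooth_mul ((hz b).partialDeriv a) (hDc a b)
  have hS2 : Torus.IsSmooth (fun x => ∑ a, ∑ b, Torus.partialDeriv a (z b) x * Torus.partialDeriv b u x a) :=
    isSmooth_sum _ fun a _ => isSmooth_sum _ fun b _ => smooth_mul ((hz b).partialDeriv a) (hDc b a)
  -- the diagonal term: `∑_{ab} ∫ ∂_a z_b (∂_a u)_b = −∑_b ∫ z_b (Δu)_b`
  have hI1 : ∫ x, ∑ a, ∑ b, Torus.partialDeriv a (z b) x * Torus.partialDeriv a u x b =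
      -∑ b, ∫ x, z b x * Torus.laplacian u x b := by
    rw [integral_finsetSum _ fun a _ => (isSmooth_sum _ fun b _ =>
      smooth_mul ((hz b).partialDeriv a) (hDc a b)).integrable]
    have h1 : ∀ a, ∫ x, ∑ b, Torus.partialDeriv a (z b) x * Torus.partialDeriv a u x b =
        ∑ b, -∫ x, z b x * Torus.partialDeriv a (fun y => Torus.partialDeriv a u y b) x := by
      intro a
      rw [integral_finsetSum _ fun b _ => (smooth_mul ((hz b).partialDeriv a) (hDc a b)).integrable]
      exact Finset.sum_congr rfl fun b _ => integral_partialDeriv_mul_eq_neg (hz b) (hDc a b) a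
    simp_rw [h1]
    rw [Finset.sum_comm, ← Finset.sum_neg_distrib]
    refine Finset.sum_congr rfl fun b _ => ?_
    rw [Finset.sum_neg_distrib, ← integral_finsetSum _ fun a _ =>
      (smooth_mul (hz b) ((hDc a b).partialDeriv a)).integrable]
    congr 1
    refine integral_congr_ae (Filter.Eventually.of_forall fun x => ?_)
    show ∑ a, z b x * Torus.partialDeriv a (fun y => Torus.partialDeriv a u y b) x =
      z b x * Torus.laplacian u x b
    rw [laplacian_apply_eq_sum hu b x, Finset.mul_sum]
  -- the cross term vanishes: `∑_{ab} ∫ ∂_a z_b (∂_b u)_a = −∑_b ∫ z_b ∂_b(div u) = 0`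
  have hI2 : ∫ x, ∑ a, ∑ b, Torus.partialDeriv a (z b) x * Torus.partialDeriv b u x a = 0 := by
    rw [integral_finsetSum _ fun a _ => (isSmooth_sum _ fun b _ =>
      smooth_mul ((hz b).partialDeriv a) (hDc b a)).integrable]
    have h1 : ∀ a, ∫ x, ∑ b, Torus.partialDeriv a (z b) x * Torus.partialDeriv b u x a =
        ∑ b, -∫ x, z b x * Torus.partialDeriv a (fun y => Torus.partialDeriv b u y a) x := by
      intro a
      rw [integral_finsetSum _ fun b _ => (smooth_mul ((hz b).partialDeriv a) (hDc b a)).integrable]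
      exact Finset.sum_congr rfl fun b _ => integral_partialDeriv_mul_eq_neg (hz b) (hDc b a) a
    simp_rw [h1]
    rw [Finset.sum_comm]
    refine Finset.sum_eq_zero fun b _ => ?_
    rw [Finset.sum_neg_distrib, ← integral_finsetSum _ fun a _ =>
      (smooth_mul (hz b) ((hDc b a).partialDeriv a)).integrable, neg_eq_zero]
    have hpt0 : ∀ x, ∑ a, z b x * Torus.partialDeriv a (fun y => Torus.partialDeriv b u y a) x = 0 := by
      intro x
      rw [← Finset.mul_sum, sum_partialDeriv_partialDeriv_apply_eq_zero hu hdiv b x, mul_zero]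
    simp_rw [hpt0]
    exact integral_zero _ _
  simp_rw [hpt]
  rw [integral_add (hS1.integrable.const_mul _) (hS2.integrable.const_mul _),
    MeasureTheory.integral_const_mul, MeasureTheory.integral_const_mul, hI1, hI2]
  ring

omit [DecidableEq d] in
/-- Moving the symmetrisation across a pairing: `∑_{ab} ½(M_{ab} + M_{ba}) G_{ab} = ∑_{ab} M_{ab} ½(G_{ba} + G_{ab})`.
[folklore] -/
private theorem sum_symm_mul_eq_mul_symm (M G : d → d → ℝ) :
    ∑ a, ∑ b, (M a b + M b a) / 2 * G a b = ∑ a, ∑ b, M a b * ((G b a + G a b) / 2) := by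
  have h1 : ∑ a, ∑ b, M b a * G a b = ∑ a, ∑ b, M a b * G b a := Finset.sum_comm
  have h2 : ∑ a, ∑ b, (M a b + M b a) / 2 * G a b =
      2⁻¹ * (∑ a, ∑ b, M a b * G a b) + 2⁻¹ * (∑ a, ∑ b, M b a * G a b) := by
    simp only [Finset.mul_sum, ← Finset.sum_add_distrib]
    exact Finset.sum_congr rfl fun a _ => Finset.sum_congr rfl fun b _ => by ring
  have h3 : ∑ a, ∑ b, M a b * ((G b a + G a b) / 2) =
      2⁻¹ * (∑ a, ∑ b, M a b * G a b) + 2⁻¹ * (∑ a, ∑ b, M a b * G b a) := by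
    simp only [Finset.mul_sum, ← Finset.sum_add_distrib]
    exact Finset.sum_congr rfl fun a _ => Finset.sum_congr rfl fun b _ => by ring
  rw [h2, h3, h1]

/-- `∫ div_{sym}M · const = 0`: each `(div_{sym} M)_b` is a sum of derivatives, so has zero mean. [folklore] -/
private theorem integral_strainDiv (hM : ∀ a b, Torus.IsSmooth (M a b)) (b : d) :
    ∫ x, Torus.strainDiv M b x = 0 := by
  unfold Torus.strainDiv
  rw [integral_finsetSum _ fun c _ => ((isSmooth_symm hM c b).partialDeriv c).integrable]
  exact Finset.sum_eq_zero fun c _ => Torus.integral_partialDeriv_eq_zero_holds (isSmooth_symm hM c b) c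

/-- The entries of `P_{st}M` through the scalar components `z_b = (z_M)_b` of the potential:
`(P_{st}M)_{ab} = ½(∂_a z_b + ∂_b z_a)`. [folklore] -/
private theorem strainProjection_eq_scalar (hM : ∀ a b, Torus.IsSmooth (M a b)) (a b : d)
    (x : UnitAddTorus d) :
    Torus.strainProjection M a b x =
      (Torus.partialDeriv a (fun y => Torus.strainPotential M y b) x +
        Torus.partialDeriv b (fun y => Torus.strainPotential M y a) x) / 2 := by
  have hZ1 : Torus.IsContDiff 1 (Torus.strainPotential M) := (Torus.isSmooth_strainPotential hM).isContDiff (by simp)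
  rw [Torus.strainProjection, Torus.partialDeriv_apply_coord hZ1, Torus.partialDeriv_apply_coord hZ1]

/-- **`M − P_{st}M ⊥ L²_{st}` (the defining property of the orthogonal projection onto the strain
space)**: for a smooth matrix field `M` on `T^d` (`d` nonempty) and every smooth divergence-free
`u`, `⟨P_{st}M, ∇_{sym}u⟩ = ⟨M, ∇_{sym}u⟩`, i.e.
`∫ ∑_{ab} (P_{st}M)_{ab} S(u)_{ab} = ∫ ∑_{ab} M_{ab} S(u)_{ab}`, `S(u)_{ab} = ½((∂_b u)_a + (∂_a u)_b)`.
Proof: `P_{st}M = ∇_{sym}z_M`, `⟨∇_{sym}z, ∇_{sym}u⟩ = −½⟨z, Δu⟩` (by parts, `div u = 0`), and for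
`z_M = 2Δ⁻¹div_{sym}M − 2∇Δ⁻²div div sym M`: the gradient part pairs to `∫ Δ⁻²(…) div Δu = 0`, the
first part gives `−⟨Δ⁻¹div_{sym}M, Δu⟩ = −⟨div_{sym}M, u⟩ = ⟨sym M, ∇u⟩` (`Δ⁻¹` symmetric,
`Δ⁻¹Δu = u − ∫u`, `∫div_{sym}M = 0`, by parts). [cite: Miller2023StrainModel, Def 1.2 (`P_{st}` the projection onto `L²_{st}`); Miller2019, Def 2.2 and Prop 2.3 (proof)] -/
theorem _root_.Literature.Analysis.FluidPDE.Torus.integral_sum_strainProjection_mul_symGrad_eq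
    [Nonempty d] (hM : ∀ a b, Torus.IsSmooth (M a b)) {u : UnitAddTorus d → EuclideanSpace ℝ d}
    (hu : Torus.IsSmooth u) (hdiv : Torus.IsDivFree u) :
    ∫ x, ∑ a, ∑ b, Torus.strainProjection M a b x *
        ((Torus.partialDeriv b u x a + Torus.partialDeriv a u x b) / 2) =
      ∫ x, ∑ a, ∑ b, M a b x * ((Torus.partialDeriv b u x a + Torus.partialDeriv a u x b) / 2) := by
  have hu1 : Torus.IsContDiff 1 u := hu.isContDiff (by simp)
  have huc : ∀ b, Torus.IsSmooth (fun y => u y b) := fun b => hu.apply b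
  have hDc : ∀ m j, Torus.IsSmooth (fun y => Torus.partialDeriv m u y j) := fun m j =>
    (hu.partialDeriv m).apply j
  have hL : Torus.IsSmooth (Torus.laplacian u) := hu.laplacian
  have hLc : ∀ b, Torus.IsSmooth (fun y => Torus.laplacian u y b) := fun b => hL.apply b
  -- names for the pieces of the potential
  set h : d → UnitAddTorus d → ℝ := Torus.strainDiv M with hh
  set ψ : UnitAddTorus d → ℝ := Torus.invLaplacian (Torus.invLaplacian (Torus.strainDivDiv M)) with hψ
  have hhs : ∀ b, Torus.IsSmooth (h b) := fun b => Torus.isSmooth_strainDiv hM b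
  have hψs : Torus.IsSmooth ψ :=
    Torus.isSmooth_invLaplacian (Torus.isSmooth_invLaplacian (Torus.isSmooth_strainDivDiv hM))
  have hIh : ∀ b, Torus.IsSmooth (Torus.invLaplacian (h b)) := fun b => Torus.isSmooth_invLaplacian (hhs b)
  set z : d → UnitAddTorus d → ℝ := fun b y => Torus.strainPotential M y b with hz
  have hzs : ∀ b, Torus.IsSmooth (z b) := fun b => Torus.isSmooth_strainPotential_apply hM b
  have hz_eq : ∀ b y, z b y = 2 * Torus.invLaplacian (h b) y - 2 * Torus.partialDeriv b ψ y := by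
    intro b y; rfl
  -- Step 1: `P_{st}M = ∇_{sym} z` entrywise, and the pairing `⟨∇_{sym}z, ∇_{sym}u⟩ = −½ ∑_b ∫ z_b (Δu)_b`
  have hP : ∀ x, ∑ a, ∑ b, Torus.strainProjection M a b x *
      ((Torus.partialDeriv b u x a + Torus.partialDeriv a u x b) / 2) =
      ∑ a, ∑ b, (Torus.partialDeriv a (z b) x + Torus.partialDeriv b (z a) x) / 2 *
        ((Torus.partialDeriv b u x a + Torus.partialDeriv a u x b) / 2) := by
    intro x
    exact Finset.sum_congr rfl fun a _ => Finset.sum_congr rfl fun b _ => by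
      rw [strainProjection_eq_scalar hM a b x]
  simp_rw [hP]
  rw [integral_sum_symGradScalar_mul_symGrad_eq hzs hu hdiv]
  -- Step 2: `∫ z_b (Δu)_b = 2∫ (Δ⁻¹h_b)(Δu)_b − 2∫ (∂_bψ)(Δu)_b`
  have hsplit : ∀ b, ∫ x, z b x * Torus.laplacian u x b =
      2 * (∫ x, Torus.invLaplacian (h b) x * Torus.laplacian u x b) -
        2 * ∫ x, Torus.partialDeriv b ψ x * Torus.laplacian u x b := by
    intro b
    have e : ∀ x, z b x * Torus.laplacian u x b =
        2 * (Torus.invLaplacian (h b) x * Torus.laplacian u x b) -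
          2 * (Torus.partialDeriv b ψ x * Torus.laplacian u x b) := by
      intro x; rw [hz_eq]; ring
    simp_rw [e]
    rw [integral_sub ((smooth_mul (hIh b) (hLc b)).integrable.const_mul 2)
      ((smooth_mul (hψs.partialDeriv b) (hLc b)).integrable.const_mul 2),
      MeasureTheory.integral_const_mul, MeasureTheory.integral_const_mul]
  -- Step 3: the gradient part vanishes in the sum over `b`: `∑_b ∫ ∂_bψ (Δu)_b = −∫ ψ div Δu = 0`
  have hgrad : ∑ b, ∫ x, Torus.partialDeriv b ψ x * Torus.laplacian u x b = 0 := by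
    have h1 : ∀ b, ∫ x, Torus.partialDeriv b ψ x * Torus.laplacian u x b =
        -∫ x, ψ x * Torus.partialDeriv b (fun y => Torus.laplacian u y b) x := fun b =>
      integral_partialDeriv_mul_eq_neg hψs (hLc b) b
    simp_rw [h1]
    rw [Finset.sum_neg_distrib, neg_eq_zero,
      ← integral_finsetSum _ fun b _ => (smooth_mul hψs ((hLc b).partialDeriv b)).integrable]
    have hpt : ∀ x, ∑ b, ψ x * Torus.partialDeriv b (fun y => Torus.laplacian u y b) x = 0 := by
      intro x
      rw [← Finset.mul_sum]
      have hdivL : Torus.divergence (Torus.laplacian u) x = 0 :=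
        Torus.IsDivFree.laplacian_of_isSmooth hu hdiv x
      rw [Torus.divergence] at hdivL
      rw [hdivL, mul_zero]
    simp_rw [hpt]
    exact integral_zero _ _
  -- Step 4: `∫ (Δ⁻¹h_b)(Δu)_b = ∫ h_b u_b` (`Δ⁻¹` symmetric, `Δ⁻¹Δu_b = u_b − ∫u_b`, `∫h_b = 0`)
  have hmain : ∀ b, ∫ x, Torus.invLaplacian (h b) x * Torus.laplacian u x b = ∫ x, h b x * u x b := by
    intro b
    have e1 : ∀ x, Torus.laplacian u x b = Torus.laplacian (fun y => u y b) x := fun x =>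
      laplacian_apply_eq_laplacian_coord hu b x
    simp_rw [e1]
    rw [integral_invLaplacian_mul_comm (hhs b) (huc b).laplacian]
    have e2 : ∀ x, h b x * Torus.invLaplacian (Torus.laplacian (fun y => u y b)) x =
        h b x * u x b - (∫ y, u y b) * h b x := by
      intro x
      rw [Torus.invLaplacian_laplacian (huc b) x]; ring
    simp_rw [e2]
    rw [integral_sub (smooth_mul (hhs b) (huc b)).integrable (smooth_const_mul _ (hhs b)).integrable,
      MeasureTheory.integral_const_mul, integral_strainDiv hM b, mul_zero, sub_zero]
  -- Step 5: `−∑_b ∫ h_b u_b = ∑_{cb} ∫ sym M_{cb} (∂_c u)_b` (by parts)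
  have hparts : ∀ b, ∫ x, h b x * u x b =
      -∑ c, ∫ x, (M c b x + M b c x) / 2 * Torus.partialDeriv c u x b := by
    intro b
    have e1 : ∀ x, h b x * u x b = ∑ c, Torus.partialDeriv c (fun y => (M c b y + M b c y) / 2) x * u x b := by
      intro x
      simp only [hh, Torus.strainDiv, Finset.sum_mul]
    simp_rw [e1]
    rw [integral_finsetSum _ fun c _ => (smooth_mul ((isSmooth_symm hM c b).partialDeriv c) (huc b)).integrable,
      ← Finset.sum_neg_distrib]
    refine Finset.sum_congr rfl fun c _ => ?_
    rw [integral_partialDeriv_mul_eq_neg (isSmooth_symm hM c b) (huc b) c]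
    congr 1
    refine integral_congr_ae (Filter.Eventually.of_forall fun x => ?_)
    show (M c b x + M b c x) / 2 * Torus.partialDeriv c (fun y => u y b) x =
      (M c b x + M b c x) / 2 * Torus.partialDeriv c u x b
    rw [Torus.partialDeriv_apply_coord hu1]
  -- assemble the left side
  have hL_eq : -(2⁻¹ * ∑ b, ∫ x, z b x * Torus.laplacian u x b) =
      ∑ b, ∑ c, ∫ x, (M c b x + M b c x) / 2 * Torus.partialDeriv c u x b := by
    simp_rw [hsplit]
    rw [Finset.sum_sub_distrib, ← Finset.mul_sum, ← Finset.mul_sum, hgrad, mul_zero, sub_zero]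
    simp_rw [hmain, hparts]
    rw [Finset.sum_neg_distrib]
    ring
  rw [hL_eq]
  -- the right side, pointwise: `∑_{ab} M_{ab} S(u)_{ab} = ∑_{cb} sym M_{cb} (∂_c u)_b`
  have hR : ∀ x, ∑ a, ∑ b, M a b x * ((Torus.partialDeriv b u x a + Torus.partialDeriv a u x b) / 2) =
      ∑ c, ∑ b, (M c b x + M b c x) / 2 * Torus.partialDeriv c u x b := by
    intro x
    rw [sum_symm_mul_eq_mul_symm (fun a b => M a b x) (fun a b => Torus.partialDeriv a u x b)]
  simp_rw [hR]
  rw [integral_finsetSum _ fun c _ => isSmooth_sum _ (fun b _ =>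
      smooth_mul (isSmooth_symm hM c b) (hDc c b)) |>.integrable, Finset.sum_comm]
  refine Finset.sum_congr rfl fun c _ => ?_
  rw [integral_finsetSum _ fun b _ => (smooth_mul (isSmooth_symm hM c b) (hDc c b)).integrable]

/-! ### Linear-combination helpers for partial derivatives -/

/-- `∂ᵢ(c f) = c ∂ᵢf` for a `C¹` scalar function. [folklore] -/
private theorem partialDeriv_const_mul' {f : UnitAddTorus d → ℝ} (hf : Torus.IsContDiff 1 f) (c : ℝ)
    (i : d) (x : UnitAddTorus d) :
    Torus.partialDeriv i (fun y => c * f y) x = c * Torus.partialDeriv i f x := by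
  have h := congrFun (Torus.partialDeriv_const_smul hf c i) x
  have e : (fun y => c * f y) = c • f := by funext y; simp [smul_eq_mul]
  rw [e, h, Pi.smul_apply, smul_eq_mul]

/-- `∂ᵢ(f − g) = ∂ᵢf − ∂ᵢg` for `C¹` functions. [folklore] -/
private theorem partialDeriv_sub' {F : Type*} [NormedAddCommGroup F] [NormedSpace ℝ F]
    {f g : UnitAddTorus d → F} (hf : Torus.IsContDiff 1 f) (hg : Torus.IsContDiff 1 g)
    (i : d) (x : UnitAddTorus d) :
    Torus.partialDeriv i (fun y => f y - g y) x = Torus.partialDeriv i f x - Torus.partialDeriv i g x := by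
  have hneg : Torus.IsContDiff 1 (fun y => -g y) := hg.neg
  have hfun : (fun y => f y - g y) = f + fun y => -g y := by
    funext y; simp [sub_eq_add_neg]
  rw [hfun, Torus.partialDeriv_add hf hneg i, Pi.add_apply, Torus.partialDeriv_neg, sub_eq_add_neg]

omit [Fintype d] in
/-- `∂ᵢ` of a constant vanishes. [folklore] -/
private theorem partialDeriv_const' {F : Type*} [NormedAddCommGroup F] [NormedSpace ℝ F] (c : F)
    (i : d) (x : UnitAddTorus d) : Torus.partialDeriv i (fun _ : UnitAddTorus d => c) x = 0 := by
  simp [Torus.partialDeriv, Torus.lineDeriv]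

/-- The derivative of a component of the potential:
`∂_a z_b = 2∂_aΔ⁻¹(div_{sym}M)_b − 2∂_a∂_bΔ⁻²(div div sym M)`. [folklore] -/
private theorem partialDeriv_strainPotential_apply (hM : ∀ a b, Torus.IsSmooth (M a b)) (a b : d)
    (x : UnitAddTorus d) :
    Torus.partialDeriv a (fun y => Torus.strainPotential M y b) x =
      2 * Torus.partialDeriv a (Torus.invLaplacian (Torus.strainDiv M b)) x -
        2 * Torus.partialDeriv a (Torus.partialDeriv b
          (Torus.invLaplacian (Torus.invLaplacian (Torus.strainDivDiv M)))) x := by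
  have h1 : Torus.IsSmooth (Torus.invLaplacian (Torus.strainDiv M b)) :=
    Torus.isSmooth_invLaplacian (Torus.isSmooth_strainDiv hM b)
  have h2 : Torus.IsSmooth (Torus.partialDeriv b
      (Torus.invLaplacian (Torus.invLaplacian (Torus.strainDivDiv M)))) :=
    (Torus.isSmooth_invLaplacian (Torus.isSmooth_invLaplacian (Torus.isSmooth_strainDivDiv hM))).partialDeriv b
  have e : (fun y => Torus.strainPotential M y b) =
      fun y => (fun y => 2 * Torus.invLaplacian (Torus.strainDiv M b) y) y -
        (fun y => 2 * Torus.partialDeriv b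
          (Torus.invLaplacian (Torus.invLaplacian (Torus.strainDivDiv M))) y) y := by
    funext y; rfl
  rw [e, partialDeriv_sub' ((smooth_const_mul 2 h1).isContDiff (by simp))
      ((smooth_const_mul 2 h2).isContDiff (by simp)),
    partialDeriv_const_mul' (h1.isContDiff (by simp)), partialDeriv_const_mul' (h2.isContDiff (by simp))]

/-! ### The potential is divergence free and mean zero -/

/-- **The potential `z_M` is divergence free** — so `P_{st}M = ∇_{sym}z_M` lies in the strain space
`L²_{st} = {∇_{sym}u : ∇·u = 0}` (Miller, ARMA 235 (2020), Def 2.2): `div z_M = 2Δ⁻¹(div div sym M)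
− 2Δ Δ⁻²(div div sym M) = 0`, the mean-zero inverse Laplacian being an honest inverse on mean-zero
functions. [cite: Miller2019, Def 2.2; Miller2023StrainModel, Def 1.2] -/
theorem _root_.Literature.Analysis.FluidPDE.Torus.isDivFree_strainPotential [Nonempty d]
    (hM : ∀ a b, Torus.IsSmooth (M a b)) : Torus.IsDivFree (Torus.strainPotential M) := by
  intro x
  set h : d → UnitAddTorus d → ℝ := Torus.strainDiv M with hh
  set g : UnitAddTorus d → ℝ := Torus.strainDivDiv M with hg
  have hhs : ∀ b, Torus.IsSmooth (h b) := fun b => Torus.isSmooth_strainDiv hM b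
  have hgs : Torus.IsSmooth g := Torus.isSmooth_strainDivDiv hM
  have hIg : Torus.IsSmooth (Torus.invLaplacian g) := Torus.isSmooth_invLaplacian hgs
  have hψs : Torus.IsSmooth (Torus.invLaplacian (Torus.invLaplacian g)) := Torus.isSmooth_invLaplacian hIg
  rw [Torus.divergence]
  simp_rw [partialDeriv_strainPotential_apply hM]
  rw [Finset.sum_sub_distrib, ← Finset.mul_sum, ← Finset.mul_sum]
  -- first sum: `∑_b ∂_bΔ⁻¹h_b = Δ⁻¹(∑_b ∂_b h_b) = Δ⁻¹g`
  have h1 : ∑ b, Torus.partialDeriv b (Torus.invLaplacian (h b)) x = Torus.invLaplacian g x := by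
    simp_rw [Torus.partialDeriv_invLaplacian (hhs _)]
    have hfun : g = ∑ b, Torus.partialDeriv b (h b) := by
      funext y; rw [hg, Torus.strainDivDiv, Finset.sum_apply]
    rw [hfun, Torus.invLaplacian_finset_sum _ fun b _ => (hhs b).partialDeriv b, Finset.sum_apply]
  -- second sum: `∑_b ∂_b∂_b Δ⁻²g = Δ Δ⁻²g = Δ⁻¹g`
  have h2 : ∑ b, Torus.partialDeriv b (Torus.partialDeriv b (Torus.invLaplacian (Torus.invLaplacian g))) x =
      Torus.invLaplacian g x := by
    rw [← Torus.laplacian_eq_sum_partialDeriv_partialDeriv hψs, Torus.laplacian_invLaplacian hIg x,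
      Torus.integral_invLaplacian hgs, sub_zero]
  rw [h1, h2, sub_self]

/-- **The potential `z_M` has zero mean** (each component is `2Δ⁻¹(…) − 2∂_b(…)`, and both the
mean-zero inverse Laplacian and a derivative integrate to zero over `T^d`), matching Miller's
homogeneous setting `u ∈ Ḣ¹` for `L²_{st}` (ARMA 235 (2020), Def 2.2). [cite: Miller2019, Def 2.2] -/
theorem _root_.Literature.Analysis.FluidPDE.Torus.integral_strainPotential_apply [Nonempty d]
    (hM : ∀ a b, Torus.IsSmooth (M a b)) (b : d) :
    ∫ x, Torus.strainPotential M x b = 0 := by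
  have h1 : Torus.IsSmooth (Torus.invLaplacian (Torus.strainDiv M b)) :=
    Torus.isSmooth_invLaplacian (Torus.isSmooth_strainDiv hM b)
  have hψs : Torus.IsSmooth (Torus.invLaplacian (Torus.invLaplacian (Torus.strainDivDiv M))) :=
    Torus.isSmooth_invLaplacian (Torus.isSmooth_invLaplacian (Torus.isSmooth_strainDivDiv hM))
  simp_rw [Torus.strainPotential_apply]
  rw [integral_sub (smooth_const_mul 2 h1).integrable (smooth_const_mul 2 (hψs.partialDeriv b)).integrable,
    MeasureTheory.integral_const_mul, MeasureTheory.integral_const_mul,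
    Torus.integral_invLaplacian (Torus.isSmooth_strainDiv hM b),
    Torus.integral_partialDeriv_eq_zero_holds hψs b, mul_zero, sub_zero]

/-! ### `P_{st}` is the identity on strains -/

/-- **`P_{st}(∇_{sym}u) = ∇_{sym}u` for smooth divergence-free `u`** (Miller, ARMA 235 (2020),
display (2.7) `u = −2 div(−Δ)⁻¹S` and Prop 2.3: "`−2 div(∇_{sym}u) = −Δu − ∇(∇·u) = −Δu`", so the
reconstruction applied to `S = ∇_{sym}u` returns `u` up to its mean, and `div div ∇_{sym}u = ½ div Δu = 0`
kills the gradient correction). [cite: Miller2019, §2 display (2.7) and Prop 2.3 (proof)] -/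
theorem _root_.Literature.Analysis.FluidPDE.Torus.strainProjection_symGrad [Nonempty d]
    {u : UnitAddTorus d → EuclideanSpace ℝ d} (hu : Torus.IsSmooth u) (hdiv : Torus.IsDivFree u)
    (a b : d) (x : UnitAddTorus d) :
    Torus.strainProjection (fun a b y => (Torus.partialDeriv b u y a + Torus.partialDeriv a u y b) / 2) a b x =
      (Torus.partialDeriv b u x a + Torus.partialDeriv a u x b) / 2 := by
  set S : d → d → UnitAddTorus d → ℝ := fun a b y =>
    (Torus.partialDeriv b u y a + Torus.partialDeriv a u y b) / 2 with hS
  have hu1 : Torus.IsContDiff 1 u := hu.isContDiff (by simp)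
  have huc : ∀ b, Torus.IsSmooth (fun y => u y b) := fun b => hu.apply b
  have hDc : ∀ m j, Torus.IsSmooth (fun y => Torus.partialDeriv m u y j) := fun m j =>
    (hu.partialDeriv m).apply j
  have hSs : ∀ a b, Torus.IsSmooth (S a b) := fun a b => ((hDc b a).add (hDc a b)).div_const 2
  -- symmetrisation is trivial on `S`
  have hsym : ∀ c b, (fun z => (S c b z + S b c z) / 2) = S c b := by
    intro c b; funext z; simp only [hS]; ring
  -- `div_{sym} S = ½ Δu` componentwise
  have hdivS : ∀ b, Torus.strainDiv S b = fun y => 2⁻¹ * Torus.laplacian (fun z => u z b) y := by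
    intro b; funext y
    rw [Torus.strainDiv]
    simp_rw [hsym]
    have e1 : ∀ c, Torus.partialDeriv c (S c b) y =
        2⁻¹ * Torus.partialDeriv c (fun z => Torus.partialDeriv b u z c) y +
          2⁻¹ * Torus.partialDeriv c (fun z => Torus.partialDeriv c u z b) y := by
      intro c
      have e : S c b = fun z => 2⁻¹ * Torus.partialDeriv b u z c + 2⁻¹ * Torus.partialDeriv c u z b := by
        funext z; simp only [hS]; ring
      rw [e]
      have hA : Torus.IsContDiff 1 (fun z => 2⁻¹ * Torus.partialDeriv b u z c) :=
        (smooth_const_mul _ (hDc b c)).isContDiff (by simp)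
      have hB : Torus.IsContDiff 1 (fun z => 2⁻¹ * Torus.partialDeriv c u z b) :=
        (smooth_const_mul _ (hDc c b)).isContDiff (by simp)
      have := congrFun (Torus.partialDeriv_add hA hB c) y
      simp only [Pi.add_apply] at this
      rw [show (fun z => 2⁻¹ * Torus.partialDeriv b u z c + 2⁻¹ * Torus.partialDeriv c u z b) =
        ((fun z => 2⁻¹ * Torus.partialDeriv b u z c) + fun z => 2⁻¹ * Torus.partialDeriv c u z b) from rfl,
        this, partialDeriv_const_mul' ((hDc b c).isContDiff (by simp)),
        partialDeriv_const_mul' ((hDc c b).isContDiff (by simp))]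
    simp_rw [e1]
    rw [Finset.sum_add_distrib, ← Finset.mul_sum, ← Finset.mul_sum,
      sum_partialDeriv_partialDeriv_apply_eq_zero hu hdiv b y, mul_zero, zero_add,
      ← laplacian_apply_eq_sum hu b y, laplacian_apply_eq_laplacian_coord hu b y]
  -- `div div S = ½ div Δu = 0`
  have hdd : Torus.strainDivDiv S = 0 := by
    funext y
    rw [Torus.strainDivDiv]
    simp_rw [hdivS]
    have e1 : ∀ b, Torus.partialDeriv b (fun y => 2⁻¹ * Torus.laplacian (fun z => u z b) y) y =
        2⁻¹ * Torus.partialDeriv b (fun z => Torus.laplacian u z b) y := by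
      intro b
      rw [partialDeriv_const_mul' ((huc b).laplacian.isContDiff (by simp))]
      congr 1
      congr 1
      funext z
      exact (laplacian_apply_eq_laplacian_coord hu b z).symm
    simp_rw [e1]
    rw [← Finset.mul_sum]
    have hdivL : Torus.divergence (Torus.laplacian u) y = 0 := Torus.IsDivFree.laplacian_of_isSmooth hu hdiv y
    rw [Torus.divergence] at hdivL
    rw [hdivL, mul_zero, Pi.zero_apply]
  -- hence the gradient correction vanishes and `Δ⁻¹(div_{sym}S)_b = ½(u_b − ∫u_b)`
  have hψ0 : Torus.invLaplacian (Torus.invLaplacian (Torus.strainDivDiv S)) = 0 := by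
    rw [hdd, Torus.invLaplacian_zero, Torus.invLaplacian_zero]
  have hIh : ∀ b y, Torus.invLaplacian (Torus.strainDiv S b) y = 2⁻¹ * (u y b - ∫ z, u z b) := by
    intro b y
    rw [hdivS b]
    have e : (fun y => 2⁻¹ * Torus.laplacian (fun z => u z b) y) = (2⁻¹ : ℝ) • Torus.laplacian (fun z => u z b) := by
      funext y; simp [smul_eq_mul]
    rw [e, Torus.invLaplacian_const_smul _ _ (huc b).laplacian, Pi.smul_apply, smul_eq_mul,
      Torus.invLaplacian_laplacian (huc b) y]
  -- the components of the potential: `z_b = u_b − ∫u_b`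
  have hz : ∀ b, (fun y => Torus.strainPotential S y b) = fun y => u y b - ∫ z, u z b := by
    intro b; funext y
    rw [Torus.strainPotential_apply, hψ0, hIh]
    simp [Torus.partialDeriv, Torus.lineDeriv]
  -- conclusion
  have hz' : ∀ a b, Torus.partialDeriv a (fun y => Torus.strainPotential S y b) x = Torus.partialDeriv a u x b := by
    intro a b
    rw [hz b, partialDeriv_sub' ((huc b).isContDiff (by simp)) (Torus.isContDiff_const _),
      partialDeriv_const', sub_zero, Torus.partialDeriv_apply_coord hu1]
  rw [strainProjection_eq_scalar hSs a b x, hz', hz', add_comm]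

/-! ### `P_{st}` is an orthogonal projection: idempotent, self-adjoint, contractive -/

/-- `P_{st}M` written as the strain `∇_{sym} z_M` in the house index order. [folklore] -/
private theorem strainProjection_eq_symGrad (M : d → d → UnitAddTorus d → ℝ) :
    Torus.strainProjection M = fun a b y =>
      (Torus.partialDeriv b (Torus.strainPotential M) y a +
        Torus.partialDeriv a (Torus.strainPotential M) y b) / 2 := by
  funext a b y
  rw [Torus.strainProjection, add_comm]

/-- **`P_{st}² = P_{st}`**: `P_{st}M = ∇_{sym}z_M` with `z_M` smooth and divergence free, and `P_{st}`
fixes such strains (Miller, ARMA 235 (2020), Def 2.2 / (2.7); Anal. PDE 16 (2023), Def 1.2: `P_{st}`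
is the projection onto `L²_{st}`). [cite: Miller2023StrainModel, Def 1.2; Miller2019, Def 2.2 and display (2.7)] -/
theorem _root_.Literature.Analysis.FluidPDE.Torus.strainProjection_strainProjection [Nonempty d]
    (hM : ∀ a b, Torus.IsSmooth (M a b)) (a b : d) (x : UnitAddTorus d) :
    Torus.strainProjection (Torus.strainProjection M) a b x = Torus.strainProjection M a b x := by
  rw [strainProjection_eq_symGrad M]
  exact Torus.strainProjection_symGrad (Torus.isSmooth_strainPotential hM) (Torus.isDivFree_strainPotential hM) a b x

/-- `⟨M, P_{st}N⟩ = ⟨P_{st}M, P_{st}N⟩` for smooth matrix fields. [folklore] -/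
private theorem integral_sum_mul_strainProjection_eq [Nonempty d] {N : d → d → UnitAddTorus d → ℝ}
    (hM : ∀ a b, Torus.IsSmooth (M a b)) (hN : ∀ a b, Torus.IsSmooth (N a b)) :
    ∫ x, ∑ a, ∑ b, M a b x * Torus.strainProjection N a b x =
      ∫ x, ∑ a, ∑ b, Torus.strainProjection M a b x * Torus.strainProjection N a b x := by
  rw [strainProjection_eq_symGrad N]
  exact (Torus.integral_sum_strainProjection_mul_symGrad_eq hM (Torus.isSmooth_strainPotential hN)
    (Torus.isDivFree_strainPotential hN)).symm

/-- **`P_{st}` is self-adjoint**: `⟨P_{st}M, N⟩ = ⟨M, P_{st}N⟩` for smooth matrix fields `M, N` on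
`T^d`, i.e. `∫ ∑_{ab} (P_{st}M)_{ab} N_{ab} = ∫ ∑_{ab} M_{ab} (P_{st}N)_{ab}` (both equal
`⟨P_{st}M, P_{st}N⟩`; an orthogonal projection — Miller, Anal. PDE 16 (2023), Def 1.2).
[cite: Miller2023StrainModel, Def 1.2 (`P_{st}` the orthogonal projection onto `L²_{st}`)] -/
theorem _root_.Literature.Analysis.FluidPDE.Torus.integral_sum_strainProjection_mul_comm [Nonempty d]
    {N : d → d → UnitAddTorus d → ℝ} (hM : ∀ a b, Torus.IsSmooth (M a b))
    (hN : ∀ a b, Torus.IsSmooth (N a b)) :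
    ∫ x, ∑ a, ∑ b, Torus.strainProjection M a b x * N a b x =
      ∫ x, ∑ a, ∑ b, M a b x * Torus.strainProjection N a b x := by
  have h1 : ∫ x, ∑ a, ∑ b, Torus.strainProjection M a b x * N a b x =
      ∫ x, ∑ a, ∑ b, N a b x * Torus.strainProjection M a b x :=
    integral_congr_ae (Filter.Eventually.of_forall fun x =>
      Finset.sum_congr rfl fun a _ => Finset.sum_congr rfl fun b _ => mul_comm _ _)
  have h2 : ∫ x, ∑ a, ∑ b, Torus.strainProjection N a b x * Torus.strainProjection M a b x =
      ∫ x, ∑ a, ∑ b, Torus.strainProjection M a b x * Torus.strainProjection N a b x :=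
    integral_congr_ae (Filter.Eventually.of_forall fun x =>
      Finset.sum_congr rfl fun a _ => Finset.sum_congr rfl fun b _ => mul_comm _ _)
  rw [h1, integral_sum_mul_strainProjection_eq hN hM, h2, ← integral_sum_mul_strainProjection_eq hM hN]

/-- **`‖P_{st}M‖²_{L²} = ⟨M, P_{st}M⟩`** for a smooth matrix field `M` on `T^d`
(`∫ ∑_{ab} (P_{st}M)_{ab}² = ∫ ∑_{ab} M_{ab}(P_{st}M)_{ab}`; orthogonal projection, Miller, Anal. PDE 16
(2023), Def 1.2). [cite: Miller2023StrainModel, Def 1.2] -/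
theorem _root_.Literature.Analysis.FluidPDE.Torus.integral_sum_strainProjection_sq_eq [Nonempty d]
    (hM : ∀ a b, Torus.IsSmooth (M a b)) :
    ∫ x, ∑ a, ∑ b, Torus.strainProjection M a b x ^ 2 =
      ∫ x, ∑ a, ∑ b, M a b x * Torus.strainProjection M a b x := by
  rw [integral_sum_mul_strainProjection_eq hM hM]
  exact integral_congr_ae (Filter.Eventually.of_forall fun x =>
    Finset.sum_congr rfl fun a _ => Finset.sum_congr rfl fun b _ => by ring)

/-! ### Cauchy–Schwarz for matrix fields and the Bessel inequality `‖P_{st}M‖ ≤ ‖M‖` -/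

omit [DecidableEq d] in
/-- **Cauchy–Schwarz in `L²(T^d; ℝ^{d×d})`**: for continuous matrix fields `A`, `B` on `T^d`,
`∫ ∑_{ab} A_{ab}B_{ab} ≤ (∫ ∑_{ab} A_{ab}²)^{1/2} (∫ ∑_{ab} B_{ab}²)^{1/2}` (nonnegativity of
`∫ ∑_{ab}(A_{ab} − tB_{ab})²` for all `t` and the discriminant). [cite: Evans2010, App. B.2 (Cauchy–Schwarz inequality)] -/
theorem _root_.Literature.Analysis.FluidPDE.Torus.integral_sum_sum_mul_le_sqrt_mul_sqrt
    {A B : d → d → UnitAddTorus d → ℝ} (hA : ∀ a b, Continuous (A a b)) (hB : ∀ a b, Continuous (B a b)) :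
    ∫ x, ∑ a, ∑ b, A a b x * B a b x ≤
      Real.sqrt (∫ x, ∑ a, ∑ b, A a b x ^ 2) * Real.sqrt (∫ x, ∑ a, ∑ b, B a b x ^ 2) := by
  set P : ℝ := ∫ x, ∑ a, ∑ b, A a b x * B a b x with hP
  set X : ℝ := ∫ x, ∑ a, ∑ b, A a b x ^ 2 with hX
  set Y : ℝ := ∫ x, ∑ a, ∑ b, B a b x ^ 2 with hY
  have hcA : Continuous fun x => ∑ a, ∑ b, A a b x ^ 2 :=
    continuous_finsetSum _ fun a _ => continuous_finsetSum _ fun b _ => (hA a b).pow 2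
  have hcB : Continuous fun x => ∑ a, ∑ b, B a b x ^ 2 :=
    continuous_finsetSum _ fun a _ => continuous_finsetSum _ fun b _ => (hB a b).pow 2
  have hcP : Continuous fun x => ∑ a, ∑ b, A a b x * B a b x :=
    continuous_finsetSum _ fun a _ => continuous_finsetSum _ fun b _ => (hA a b).mul (hB a b)
  have hX0 : 0 ≤ X := integral_nonneg fun x => Finset.sum_nonneg fun a _ => Finset.sum_nonneg fun b _ => sq_nonneg _
  have hY0 : 0 ≤ Y := integral_nonneg fun x => Finset.sum_nonneg fun a _ => Finset.sum_nonneg fun b _ => sq_nonneg _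
  -- the quadratic `t ↦ ∫ ∑(B t − A)² = Y t² − 2P t + X ≥ 0`
  have hquad : ∀ t : ℝ, 0 ≤ Y * (t * t) + (-2 * P) * t + X := by
    intro t
    have hpt : ∀ x, ∑ a, ∑ b, (t * B a b x - A a b x) ^ 2 =
        t ^ 2 * (∑ a, ∑ b, B a b x ^ 2) + (-2 * t) * (∑ a, ∑ b, A a b x * B a b x) +
          ∑ a, ∑ b, A a b x ^ 2 := by
      intro x
      simp only [Finset.mul_sum, ← Finset.sum_add_distrib]
      exact Finset.sum_congr rfl fun a _ => Finset.sum_congr rfl fun b _ => by ring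
    have h0 : 0 ≤ ∫ x, ∑ a, ∑ b, (t * B a b x - A a b x) ^ 2 :=
      integral_nonneg fun x => Finset.sum_nonneg fun a _ => Finset.sum_nonneg fun b _ => sq_nonneg _
    simp_rw [hpt] at h0
    have i1 : Integrable (fun x => t ^ 2 * ∑ a, ∑ b, B a b x ^ 2) volume :=
      hcB.integrable_unitAddTorus.const_mul _
    have i2 : Integrable (fun x => (-2 * t) * ∑ a, ∑ b, A a b x * B a b x) volume :=
      hcP.integrable_unitAddTorus.const_mul _
    have i12 : Integrable (fun x => t ^ 2 * (∑ a, ∑ b, B a b x ^ 2) +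
        (-2 * t) * ∑ a, ∑ b, A a b x * B a b x) volume := i1.add i2
    have i3 : Integrable (fun x => ∑ a, ∑ b, A a b x ^ 2) volume := hcA.integrable_unitAddTorus
    rw [integral_add i12 i3, integral_add i1 i2, MeasureTheory.integral_const_mul,
      MeasureTheory.integral_const_mul] at h0
    have e : Y * (t * t) + (-2 * P) * t + X = t ^ 2 * Y + (-2 * t) * P + X := by ring
    rw [e]; exact h0
  have hdisc := discrim_le_zero hquad
  rw [discrim] at hdisc
  have hPXY : P ^ 2 ≤ X * Y := by nlinarith [hdisc]
  calc P ≤ |P| := le_abs_self P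
    _ = Real.sqrt (P ^ 2) := (Real.sqrt_sq_eq_abs P).symm
    _ ≤ Real.sqrt (X * Y) := Real.sqrt_le_sqrt hPXY
    _ = Real.sqrt X * Real.sqrt Y := Real.sqrt_mul hX0 Y

/-- **Bessel: `‖P_{st}M‖_{L²} ≤ ‖M‖_{L²}`** for a smooth matrix field `M` on `T^d`
(`∫ ∑_{ab} (P_{st}M)_{ab}² ≤ ∫ ∑_{ab} M_{ab}²`; from `‖P_{st}M‖² = ⟨M, P_{st}M⟩ ≤ ‖M‖‖P_{st}M‖` —
orthogonal projections are contractions; Miller, Anal. PDE 16 (2023), Def 1.2).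
[cite: Miller2023StrainModel, Def 1.2] -/
theorem _root_.Literature.Analysis.FluidPDE.Torus.integral_sum_strainProjection_sq_le [Nonempty d]
    (hM : ∀ a b, Torus.IsSmooth (M a b)) :
    ∫ x, ∑ a, ∑ b, Torus.strainProjection M a b x ^ 2 ≤ ∫ x, ∑ a, ∑ b, M a b x ^ 2 := by
  set X : ℝ := ∫ x, ∑ a, ∑ b, Torus.strainProjection M a b x ^ 2 with hX
  set Y : ℝ := ∫ x, ∑ a, ∑ b, M a b x ^ 2 with hY
  have hX0 : 0 ≤ X := integral_nonneg fun x => Finset.sum_nonneg fun a _ => Finset.sum_nonneg fun b _ => sq_nonneg _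
  have hY0 : 0 ≤ Y := integral_nonneg fun x => Finset.sum_nonneg fun a _ => Finset.sum_nonneg fun b _ => sq_nonneg _
  have h1 : X ≤ Real.sqrt Y * Real.sqrt X := by
    have hcs := Torus.integral_sum_sum_mul_le_sqrt_mul_sqrt (fun a b => (hM a b).continuous)
      (fun a b => (Torus.isSmooth_strainProjection hM a b).continuous)
    rw [← Torus.integral_sum_strainProjection_sq_eq hM] at hcs
    exact hcs
  -- `X ≤ √Y √X` ⇒ `√X ≤ √Y` ⇒ `X ≤ Y`
  have h2 : Real.sqrt X * Real.sqrt X ≤ Real.sqrt Y * Real.sqrt X := by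
    rw [Real.mul_self_sqrt hX0]; exact h1
  rcases hX0.eq_or_lt with h0 | hpos
  · rw [← h0]; exact hY0
  · have hsX : 0 < Real.sqrt X := Real.sqrt_pos.2 hpos
    have h3 : Real.sqrt X ≤ Real.sqrt Y := le_of_mul_le_mul_right h2 hsX
    calc X = Real.sqrt X ^ 2 := (Real.sq_sqrt hX0).symm
      _ ≤ Real.sqrt Y ^ 2 := pow_le_pow_left₀ hsX.le h3 2
      _ = Y := Real.sq_sqrt hY0

/-! ### Hessians and multiples of the identity are annihilated (Miller, Prop 2.4) -/

omit [DecidableEq d] in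
/-- `∫ Δf = 0` for smooth real `f` on `T^d`. [folklore] -/
private theorem integral_laplacian_eq_zero' [DecidableEq d] {f : UnitAddTorus d → ℝ} (hf : Torus.IsSmooth f) :
    ∫ x, Torus.laplacian f x = 0 := by
  simp_rw [Torus.laplacian_eq_sum_partialDeriv_partialDeriv hf]
  rw [integral_finsetSum _ fun i _ => ((hf.partialDeriv i).partialDeriv i).integrable]
  exact Finset.sum_eq_zero fun i _ => Torus.integral_partialDeriv_eq_zero_holds (hf.partialDeriv i) i

/-- The mean-zero inverse Laplacian kills constants: `Δ⁻¹c = 0`. [folklore] -/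
private theorem invLaplacian_const [Nonempty d] (c : ℝ) :
    Torus.invLaplacian (fun _ : UnitAddTorus d => c) = 0 := by
  have hc : Torus.IsSmooth (fun _ : UnitAddTorus d => c) := Torus.isSmooth_const c
  have hw : Torus.IsSmooth (Torus.invLaplacian (fun _ : UnitAddTorus d => c)) := Torus.isSmooth_invLaplacian hc
  -- `Δ(Δ⁻¹c) = c − ∫c = 0`
  have hΔ : Torus.laplacian (Torus.invLaplacian (fun _ : UnitAddTorus d => c)) = 0 := by
    funext x
    rw [Torus.laplacian_invLaplacian hc x, MeasureTheory.integral_const, smul_eq_mul]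
    simp
  -- `w = Δ⁻¹(Δw) + ∫w = 0`
  funext x
  have h1 := Torus.invLaplacian_laplacian hw x
  rw [Torus.integral_invLaplacian hc, sub_zero, hΔ, Torus.invLaplacian_zero] at h1
  simpa using h1.symm

/-- **`P_{st}(Hess f) = 0`** for smooth real `f` on `T^d` — Hessians are orthogonal to the strain space
(Miller, ARMA 235 (2020), Prop 2.4: "for all `f ∈ Ḣ²`, … `Hess(f) ∈ (L²_{st})^⊥`"; whence
`P_{st}(Hess p) = 0` in the strain equation, Anal. PDE 16 (2023), Prop 1.3 / eq. (1.9)). Here: the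
explicit representative vanishes identically (`div_{sym}Hess f = ∇Δf`, `Δ⁻¹∇Δf = ∇f`,
`Δ⁻²div div Hess f = Δ⁻²Δ²f = f − ∫f`, so `z = 2∇f − 2∇f = 0`). [cite: Miller2019, Prop 2.4; Miller2023StrainModel, Prop 1.3] -/
theorem _root_.Literature.Analysis.FluidPDE.Torus.strainProjection_hessian [Nonempty d]
    {f : UnitAddTorus d → ℝ} (hf : Torus.IsSmooth f) (a b : d) (x : UnitAddTorus d) :
    Torus.strainProjection (fun a b y => Torus.partialDeriv a (Torus.partialDeriv b f) y) a b x = 0 := by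
  set M : d → d → UnitAddTorus d → ℝ := fun a b y => Torus.partialDeriv a (Torus.partialDeriv b f) y with hM
  have hMs : ∀ a b, Torus.IsSmooth (M a b) := fun a b => (hf.partialDeriv b).partialDeriv a
  have hLf : Torus.IsSmooth (Torus.laplacian f) := hf.laplacian
  -- symmetrisation is trivial (Schwarz)
  have hsym : ∀ c b, (fun z => (M c b z + M b c z) / 2) = Torus.partialDeriv c (Torus.partialDeriv b f) := by
    intro c b; funext z
    simp only [hM]
    rw [Torus.partialDeriv_comm hf b c z]; ring
  -- `div_{sym} M = ∇Δf`
  have hdiv : ∀ b, Torus.strainDiv M b = Torus.partialDeriv b (Torus.laplacian f) := by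
    intro b; funext y
    rw [Torus.strainDiv]
    simp_rw [hsym]
    have e : ∀ c, Torus.partialDeriv c (Torus.partialDeriv c (Torus.partialDeriv b f)) y =
        Torus.partialDeriv b (Torus.partialDeriv c (Torus.partialDeriv c f)) y := by
      intro c
      rw [show Torus.partialDeriv c (Torus.partialDeriv b f) = Torus.partialDeriv b (Torus.partialDeriv c f) from
        funext fun z => Torus.partialDeriv_comm hf c b z,
        Torus.partialDeriv_comm (hf.partialDeriv c) c b y]
    simp_rw [e]
    rw [← Torus.partialDeriv_finset_sum _ fun c _ => ((hf.partialDeriv c).partialDeriv c).isContDiff (by simp)]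
    congr 1
    funext z
    exact (Torus.laplacian_eq_sum_partialDeriv_partialDeriv hf z).symm
  -- `div div M = Δ²f`
  have hdd : Torus.strainDivDiv M = Torus.laplacian (Torus.laplacian f) := by
    funext y
    rw [Torus.strainDivDiv]
    simp_rw [hdiv]
    exact (Torus.laplacian_eq_sum_partialDeriv_partialDeriv hLf y).symm
  -- `Δ⁻²Δ²f = f − ∫f`
  have hψ : Torus.invLaplacian (Torus.invLaplacian (Torus.strainDivDiv M)) = fun y => f y - ∫ z, f z := by
    rw [hdd]
    have h1 : Torus.invLaplacian (Torus.laplacian (Torus.laplacian f)) = Torus.laplacian f := by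
      funext y
      rw [Torus.invLaplacian_laplacian hLf y, integral_laplacian_eq_zero' hf, sub_zero]
    rw [h1]
    funext y
    exact Torus.invLaplacian_laplacian hf y
  -- the derivative of each component of the potential vanishes
  have hz : ∀ a b, Torus.partialDeriv a (fun y => Torus.strainPotential M y b) x = 0 := by
    intro a b
    rw [partialDeriv_strainPotential_apply hMs, hdiv, hψ]
    have e1 : Torus.partialDeriv a (Torus.invLaplacian (Torus.partialDeriv b (Torus.laplacian f))) x =
        Torus.partialDeriv a (Torus.partialDeriv b f) x := by
      have hfun : Torus.invLaplacian (Torus.partialDeriv b (Torus.laplacian f)) = Torus.partialDeriv b f := by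
        funext y
        rw [← Torus.partialDeriv_invLaplacian hLf b y]
        have hg : Torus.invLaplacian (Torus.laplacian f) = fun z => f z - ∫ w, f w :=
          funext fun z => Torus.invLaplacian_laplacian hf z
        rw [hg, partialDeriv_sub' (hf.isContDiff (by simp)) (Torus.isContDiff_const _), partialDeriv_const',
          sub_zero]
      rw [hfun]
    have e2 : Torus.partialDeriv a (Torus.partialDeriv b (fun y => f y - ∫ z, f z)) x =
        Torus.partialDeriv a (Torus.partialDeriv b f) x := by
      have hfun : Torus.partialDeriv b (fun y => f y - ∫ z, f z) = Torus.partialDeriv b f := by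
        funext y
        rw [partialDeriv_sub' (hf.isContDiff (by simp)) (Torus.isContDiff_const _), partialDeriv_const', sub_zero]
      rw [hfun]
    rw [e1, e2, sub_self]
  rw [strainProjection_eq_scalar hMs a b x, hz, hz]
  simp

/-- **`P_{st}(g I) = 0`** for smooth real `g` on `T^d` — multiples of the identity are orthogonal to
the strain space (Miller, ARMA 235 (2020), Prop 2.4: "`⟨gI₃, S⟩ = ∫ tr(S) g = 0`"; whence the
`−¼|ω|²I₃` term drops from the projected strain equation, Anal. PDE 16 (2023), Prop 1.3 / (1.9)).
Here: `div_{sym}(gI) = ∇g`, `Δ⁻¹∇g = ∇Δ⁻¹g`, `Δ⁻²div div(gI) = Δ⁻²Δg = Δ⁻¹g`, so `z = 0`.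
[cite: Miller2019, Prop 2.4; Miller2023StrainModel, Prop 1.3] -/
theorem _root_.Literature.Analysis.FluidPDE.Torus.strainProjection_diagonal [Nonempty d]
    {g : UnitAddTorus d → ℝ} (hg : Torus.IsSmooth g) (a b : d) (x : UnitAddTorus d) :
    Torus.strainProjection (fun a b y => if a = b then g y else 0) a b x = 0 := by
  set M : d → d → UnitAddTorus d → ℝ := fun a b y => if a = b then g y else 0 with hM
  have hMs : ∀ a b, Torus.IsSmooth (M a b) := by
    intro a b
    by_cases h : a = b
    · have e : M a b = g := by funext y; simp [hM, h]
      rw [e]; exact hg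
    · have e : M a b = fun _ => 0 := by funext y; simp [hM, h]
      rw [e]; exact Torus.isSmooth_const _
  have hIg : Torus.IsSmooth (Torus.invLaplacian g) := Torus.isSmooth_invLaplacian hg
  -- symmetrisation is trivial
  have hsym : ∀ c b, (fun z => (M c b z + M b c z) / 2) = fun z => if c = b then g z else 0 := by
    intro c b; funext z
    by_cases h : c = b
    · subst h; simp [hM]
    · have h' : ¬ b = c := fun e => h e.symm
      simp [hM, h, h']
  -- `div_{sym}(gI) = ∇g`
  have hdiv : ∀ b, Torus.strainDiv M b = Torus.partialDeriv b g := by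
    intro b; funext y
    rw [Torus.strainDiv]
    simp_rw [hsym]
    have e : ∀ c, Torus.partialDeriv c (fun z => if c = b then g z else 0) y =
        if c = b then Torus.partialDeriv b g y else 0 := by
      intro c
      by_cases h : c = b
      · subst h; simp
      · simp [h, partialDeriv_const']
    simp_rw [e]
    simp
  -- `div div (gI) = Δg`
  have hdd : Torus.strainDivDiv M = Torus.laplacian g := by
    funext y
    rw [Torus.strainDivDiv]
    simp_rw [hdiv]
    exact (Torus.laplacian_eq_sum_partialDeriv_partialDeriv hg y).symm
  -- `Δ⁻²Δg = Δ⁻¹g`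
  have hψ : Torus.invLaplacian (Torus.invLaplacian (Torus.strainDivDiv M)) = Torus.invLaplacian g := by
    rw [hdd]
    have h1 : Torus.invLaplacian (Torus.laplacian g) = (fun y => g y) - fun _ => ∫ z, g z := by
      funext y
      rw [Torus.invLaplacian_laplacian hg y, Pi.sub_apply]
    rw [h1, Torus.invLaplacian_sub hg (Torus.isSmooth_const _), invLaplacian_const, sub_zero]
  have hz : ∀ a b, Torus.partialDeriv a (fun y => Torus.strainPotential M y b) x = 0 := by
    intro a b
    rw [partialDeriv_strainPotential_apply hMs, hdiv, hψ]
    have hfun : Torus.invLaplacian (Torus.partialDeriv b g) = Torus.partialDeriv b (Torus.invLaplacian g) := by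
      funext y; exact (Torus.partialDeriv_invLaplacian hg b y).symm
    rw [hfun, sub_self]
  rw [strainProjection_eq_scalar hMs a b x, hz, hz]
  simp

end StrainProjection

end Literature.Analysis.FluidPDE
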